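import Literature.AlgebraicGeometry.Motives.OsculatingLineFamilyCycle
import Literature.AlgebraicGeometry.Motives.TangentLineMultiplicity
import HarnessLib

/-!
# The divisor of the cubic on a family of tangent lines: `pr₁^*V₊(F) · [W] = 2 [σ_x] + [σ_y] + V`

Companion to `Motives/OsculatingLineFamilyCycle` (the osculating lines of Mboro's Thm. 1.2, where
the horizontal part is `3 [σ_x]`). R. Mboro, *Remarks on the `CH₂` of cubic hypersurfaces*
(arXiv:1701.04488), proof of Thm. 1.3 (p. 8), uses instead the lines TANGENT to the cubic `X` at a
point `x` ("the residual point to `x` (`x` has multiplicity `2`) in the intersection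
`X ∩ l_{(x,v)}`"). For a family of such lines over an integral base `B` — generic line the `K`-line
`l = [x][y]` of `ℙᴺ_K`, `K = k(B)`, tangent to `V₊(F ⊗ 1)` at `[x]` with residual point `[y]`
(`F(s x + t y) = c s t²`, `c ≠ 0`) — the intersection cycle of the pulled-back divisor `pr₁^*V₊(F)`
with the threefold `W = closure ι(l) ⊆ ℙᴺ ×ₖ B` swept out by the lines is

  `pr₁^*V₊(F) · [W] = 2 [closure ι([x])] + [closure ι([y])] + V`,

`V` effective and supported over a proper closed subset of `B` on points `w` with `F ∈ 𝔭_{pr₁ w}`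
(`exists_primeInter_pullbackFormDivisor_line_eq_of_tangent`). It is deduced from the general
two-point statement `exists_primeInter_pullbackFormDivisor_eq_smul_add_smul_add` (horizontal part
`m [σ_x] + m' [σ_y]` whenever `V₊(G ⊗ 1) · [l] = m [x] + m' [y]` on the generic fibre; the
coefficients over `η_B` are those on `ℙᴺ_K`, `primeInter_pullbackFormDivisor_genericFibreι` of
`Motives/FormDivisorGenericFibre`) and the multiplicity computation on `ℙᴺ_K`
(`ProjSpace.primeInter_formDivisor_line_eq_two_smul_add`, `Motives/TangentLineMultiplicity`).

Everything is proved; no named facts.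

## References

* [Mboro2018] R. Mboro, Remarks on the CH₂ of cubic hypersurfaces, arXiv:1701.04488, proof of
  Thm. 1.3 (p. 8) and of Thm. 1.2, Case 2 (p. 7: "`(f_* ℙ_Σ̃)|_X = dΣ + R`").
* [Fulton1998] W. Fulton, Intersection Theory, 2nd ed. (1998), Def. 2.3, Thm. 2.4.
-/

noncomputable section

open CategoryTheory CategoryTheory.Limits AlgebraicGeometry Order MonoidalCategory Topology
  TopologicalSpace
open MvPolynomial (eval)
open Literature.AlgebraicGeometry.Motives.Segre Literature.AlgebraicGeometry.Motives.RatFn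

universe u

namespace Literature.AlgebraicGeometry.Motives

attribute [local instance] MvPolynomial.gradedAlgebra

namespace ProjFamily

open ProjBaseChangeRing ProjSpace ProjectiveSpace

variable {k : Type u} [Field k] {N : ℕ} {B : SchemeOver k} [IsIntegral B.left] [LocallyOfFiniteType B.hom]

/-! ### The decomposition `pr₁^*V₊(G) · [closure ι(l)] = m [closure ι(x)] + m' [closure ι(y)] + V` -/

/-- **Horizontal part on the generic fibre (two points), vertical part over a proper closed subset
of the base.** For a form `G` over `k` of degree `e ≥ 1`, the `K`-line `l = V₊(μ)` of `ℙᴺ_K`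
(`K = k(B)`) not on `V₊(G ⊗ 1)`, and two closed points `x, y` of `l` with
`V₊(G ⊗ 1) · [l] = m [x] + m' [y]` on `ℙᴺ_K`: the intersection cycle `pr₁^*V₊(G) · [closure ι(l)]`
on `ℙᴺ ×ₖ B` is `m [closure ι(x)] + m' [closure ι(y)] + V` with `V` effective and supported on
points `w` with `ι(l) ⤳ w`, `dim w = dim B`, `pr₂ w ≠ η_B` and `G ∈ 𝔭_{pr₁ w}` (the points over
`η_B` are those of the generic fibre, where the coefficients are computed on `ℙᴺ_K`,
`primeInter_pullbackFormDivisor_genericFibreι`). [cite: Fulton1998, Def. 2.3 and Thm. 2.4] [cite: Mboro2018, proof of Thm. 1.2, Case 2 (arXiv:1701.04488, p. 7)] -/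
theorem exists_primeInter_pullbackFormDivisor_eq_smul_add_smul_add (hN : 1 ≤ N) {b : ℕ}
    (hb : height (genericPoint B.left) = b) {e : ℕ} (he : 0 < e)
    {G : MvPolynomial (Fin (N + 1)) k} (hG : G ∈ grading (Fin (N + 1)) k e) (hG0 : G ≠ 0)
    {μ : Fin (N - 1) → MvPolynomial (Fin (N + 1)) B.left.functionField}
    (hμli : LinearIndependent B.left.functionField μ) (hμhom : ∀ l, (μ l).IsHomogeneous 1)
    (hGlam : MvPolynomial.map (algebraMap k B.left.functionField) G ∉
      ProjectiveSpectrum.asHomogeneousIdeal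
        (𝒜 := MvPolynomial.homogeneousSubmodule (Fin (N + 1)) B.left.functionField)
        (linearSubspacePoint μ hμli hμhom (Nat.sub_le N 1)))
    {xP yP : ↥(projectiveSpace N B.left.functionField).left}
    (hlamxP : linearSubspacePoint μ hμli hμhom (Nat.sub_le N 1) ⤳ xP) (hxP0 : height xP = 0)
    (hlamyP : linearSubspacePoint μ hμli hμhom (Nat.sub_le N 1) ⤳ yP) (hyP0 : height yP = 0)
    {m m' : ℕ}
    (hK : ∀ (hGK : MvPolynomial.map (algebraMap k B.left.functionField) G ∈
        grading (Fin (N + 1)) B.left.functionField e) (hGK0),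
        (formDivisor (MvPolynomial.map (algebraMap k B.left.functionField) G) hGK
          hGK0).primeInter (X := projectiveSpace N B.left.functionField)
            (linearSubspacePoint μ hμli hμhom (Nat.sub_le N 1)) =
          m • primeCycle xP + m' • primeCycle yP) :
    ∃ V : AlgebraicCycle ((projectiveSpace N k) ⊗ B).left ℤ,
      (pullbackFormDivisor (B := B) hG hG0).primeInter (X := (projectiveSpace N k) ⊗ B)
          (genericFibreι N B (linearSubspacePoint μ hμli hμhom (Nat.sub_le N 1))) =
        m • primeCycle (genericFibreι N B xP) + m' • primeCycle (genericFibreι N B yP) + V ∧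
      (∀ w, 0 ≤ V w) ∧
      ∀ w, V w ≠ 0 →
        genericFibreι N B (linearSubspacePoint μ hμli hμhom (Nat.sub_le N 1)) ⤳ w ∧
        height w = b ∧
        (CartesianMonoidalCategory.snd (projectiveSpace N k) B).left w ≠ genericPoint B.left ∧
        G ∈ ProjectiveSpectrum.asHomogeneousIdeal
          (𝒜 := MvPolynomial.homogeneousSubmodule (Fin (N + 1)) k)
          ((CartesianMonoidalCategory.fst (projectiveSpace N k) B).left w) := by
  classical
  -- notation
  let ι := genericFibreι N B
  let lam : ↥(projectiveSpace N B.left.functionField).left :=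
    linearSubspacePoint μ hμli hμhom (Nat.sub_le N 1)
  let H : AlgebraicCycle ((projectiveSpace N k) ⊗ B).left ℤ :=
    m • primeCycle (ι xP) + m' • primeCycle (ι yP)
  have hι_inj : Function.Injective ι.base := ι.isEmbedding.injective
  have havs : (pullbackFormDivisor (B := B) hG hG0).Avoids (ι lam) :=
    (pullbackFormDivisor_avoids_genericFibreι_iff hG hG0 he lam).2 hGlam
  -- heights
  have hlam1 : height lam = 1 := height_linearSubspacePoint_of_line hN μ hμli hμhom
  have hιlam : height (ι lam) = b + 1 := by
    change height (genericFibreι N B lam) = _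
    rw [height_genericFibreι_apply N B hb, hlam1]
  have hxPlam : xP ≠ lam := by
    intro h
    have h' := hxP0
    rw [h, hlam1] at h'
    exact one_ne_zero h'
  have hyPlam : yP ≠ lam := by
    intro h
    have h' := hyP0
    rw [h, hlam1] at h'
    exact one_ne_zero h'
  -- values of `H`
  have hHapply : ∀ q, H (ι q) = (m • primeCycle xP + m' • primeCycle yP) q := by
    intro q
    simp only [H, Function.locallyFinsuppWithin.coe_add, Function.locallyFinsuppWithin.coe_nsmul,
      Pi.add_apply, Pi.smul_apply, primeCycle_apply_of_injective' hι_inj]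
  have hH0 : ∀ w, w ≠ ι xP → w ≠ ι yP → H w = 0 := by
    intro w hwx hwy
    simp only [H, Function.locallyFinsuppWithin.coe_add, Function.locallyFinsuppWithin.coe_nsmul,
      Pi.add_apply, Pi.smul_apply, primeCycle_apply_of_ne hwx, primeCycle_apply_of_ne hwy,
      nsmul_zero, add_zero]
  -- the coefficients over `η_B`
  have hhor : ∀ w, ι lam ⤳ w →
      (CartesianMonoidalCategory.snd (projectiveSpace N k) B).left w = genericPoint B.left →
      (pullbackFormDivisor (B := B) hG hG0).primeInter (X := (projectiveSpace N k) ⊗ B) (ι lam) w =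
        H w := by
    intro w hw hwη
    obtain ⟨q, rfl, hlamq⟩ := exists_eq_genericFibreι_of_specializes N B hw hwη
    change _ = H (ι q)
    rw [hHapply]
    by_cases hq : q = lam
    · subst hq
      rw [CartierDivisor.primeInter_apply_eq_zero_of_avoids _ _ havs]
      simp only [Function.locallyFinsuppWithin.coe_add, Function.locallyFinsuppWithin.coe_nsmul,
        Pi.add_apply, Pi.smul_apply, primeCycle_apply_of_ne hxPlam.symm,
        primeCycle_apply_of_ne hyPlam.symm, nsmul_zero, add_zero]
    · have hqz : q ∈ ProjectiveSpectrum.zeroLocus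
          (MvPolynomial.homogeneousSubmodule (Fin (N + 1)) B.left.functionField) (Set.range μ) := by
        rw [← closure_linearSubspacePoint μ hμli hμhom (Nat.sub_le N 1)]
        exact specializes_iff_mem_closure.mp hlamq
      have hq0 : height q = 0 := height_eq_zero_of_mem_line hN μ hμli hμhom hqz hq
      have hcodim : height q + 1 = height lam := by rw [hq0, hlam1, zero_add]
      change (pullbackFormDivisor (B := B) hG hG0).primeInter (X := (projectiveSpace N k) ⊗ B)
        (genericFibreι N B lam) (genericFibreι N B q) = _
      rw [primeInter_pullbackFormDivisor_genericFibreι hG hG0 he hlamq hcodim hGlam, hK]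
  -- the two horizontal points
  have hHx : (pullbackFormDivisor (B := B) hG hG0).primeInter (X := (projectiveSpace N k) ⊗ B)
      (ι lam) (ι xP) = H (ι xP) :=
    hhor (ι xP) ((genericFibreι_specializes_iff N B lam xP).2 hlamxP) (snd_genericFibreι_apply N B xP)
  have hHy : (pullbackFormDivisor (B := B) hG hG0).primeInter (X := (projectiveSpace N k) ⊗ B)
      (ι lam) (ι yP) = H (ι yP) :=
    hhor (ι yP) ((genericFibreι_specializes_iff N B lam yP).2 hlamyP) (snd_genericFibreι_apply N B yP)
  -- the decomposition
  refine ⟨(pullbackFormDivisor (B := B) hG hG0).primeInter (X := (projectiveSpace N k) ⊗ B) (ι lam) -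
    H, (add_sub_cancel _ _).symm, fun w => ?_, fun w hw => ?_⟩
  · -- effectivity
    simp only [Function.locallyFinsuppWithin.coe_sub, Pi.sub_apply]
    by_cases hwx : w = ι xP
    · rw [hwx, hHx, sub_self]
    by_cases hwy : w = ι yP
    · rw [hwy, hHy, sub_self]
    rw [hH0 w hwx hwy, sub_zero]
    exact CartierDivisor.primeInter_nonneg ((isEffective_formDivisor hG hG0).pullbackAvoiding _ _) havs w
  · -- support
    have hwx : w ≠ ι xP := by
      rintro rfl
      apply hw
      simp only [Function.locallyFinsuppWithin.coe_sub, Pi.sub_apply]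
      rw [hHx, sub_self]
    have hwy : w ≠ ι yP := by
      rintro rfl
      apply hw
      simp only [Function.locallyFinsuppWithin.coe_sub, Pi.sub_apply]
      rw [hHy, sub_self]
    have hZw : (pullbackFormDivisor (B := B) hG hG0).primeInter (X := (projectiveSpace N k) ⊗ B)
        (ι lam) w ≠ 0 := by
      intro h0
      apply hw
      simp only [Function.locallyFinsuppWithin.coe_sub, Pi.sub_apply]
      rw [h0, hH0 w hwx hwy, sub_zero]
    have hsp : ι lam ⤳ w := CartierDivisor.specializes_of_primeInter_ne_zero _ hZw
    refine ⟨hsp, ?_, fun hwη => hw ?_, ?_⟩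
    · exact CartierDivisor.primeInter_mem_cyclesOfDim (X := (projectiveSpace N k) ⊗ B)
        (pullbackFormDivisor (B := B) hG hG0) (z := ι lam) (d := b) hιlam w hZw
    · simp only [Function.locallyFinsuppWithin.coe_sub, Pi.sub_apply]
      rw [hhor w hsp hwη, sub_self]
    · have hnav := CartierDivisor.not_avoids_of_primeInter_ne_zero _ hZw
      rw [pullbackFormDivisor_avoids_iff hG hG0 he] at hnav
      exact not_not.mp hnav

/-! ### The cubic and a tangent line: `pr₁^*V₊(F) · [closure ι(l)] = 2 [closure ι([x])] + [closure ι([y])] + V` -/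

omit [IsIntegral B.left] [LocallyOfFiniteType B.hom] in
/-- The `K`-points of independent vectors are distinct (a linear form vanishes at `x` but not at
`y`). [folklore] -/
theorem pt_pointOfVec_ne_of_linearIndependent {K : Type u} [Field K] [Infinite K] (hN : 1 ≤ N)
    {x y : Fin (N + 1) → K} (hxy : LinearIndependent K ![x, y]) :
    (pointOfVec K x (by simpa using hxy.ne_zero 0)).pt ≠ (pointOfVec K y (by simpa using hxy.ne_zero 1)).pt := by
  have hx0 : x ≠ 0 := by simpa using hxy.ne_zero 0
  have hy0 : y ≠ 0 := by simpa using hxy.ne_zero 1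
  obtain ⟨lam, hlamhom, hlamx, hlamy⟩ := exists_linearForm_eval_eq_zero_ne_zero hN hxy
  intro h
  have hxmem : (pointOfVec K x hx0).pt ∈ ProjectiveSpectrum.zeroLocus
      (MvPolynomial.homogeneousSubmodule (Fin (N + 1)) K) {lam} := by
    rw [pt_pointOfVec_mem_zeroLocus_iff x hx0 zero_lt_one ((MvPolynomial.mem_homogeneousSubmodule 1 lam).2 hlamhom)]
    exact hlamx
  rw [h, pt_pointOfVec_mem_zeroLocus_iff y hy0 zero_lt_one
    ((MvPolynomial.mem_homogeneousSubmodule 1 lam).2 hlamhom)] at hxmem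
  exact hlamy hxmem

variable [Infinite k]

/-- **`q^*X = 2 σ_x(Σ) + σ_y(Σ) + D'` with `D'` over a proper closed subset of the base** for the
family of TANGENT lines (Mboro, arXiv:1701.04488, proof of Thm. 1.3, p. 8: "`x` has multiplicity
`2`" and one residual point), over an integral base `B` with generic line the `K`-line `l = V₊(μ)`
through `[x], [y]` tangent to the cubic `V₊(F)` at `[x]` and meeting it again at `[y]`
(`F(s x + t y) = c s t²`, `c ≠ 0`): the intersection cycle `pr₁^*V₊(F) · [closure ι(l)]` on
`ℙᴺ ×ₖ B` is `2 [closure ι([x])] + [closure ι([y])] + V` with `V` effective and supported on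
points `w` with `ι(l) ⤳ w`, `dim w = dim B`, `pr₂ w ≠ η_B` and `F ∈ 𝔭_{pr₁ w}`
(`ProjSpace.primeInter_formDivisor_line_eq_two_smul_add` on the generic fibre).
[cite: Mboro2018, proof of Thm. 1.3 (arXiv:1701.04488, p. 8)] [cite: Fulton1998, Def. 2.3 and Thm. 2.4] -/
theorem exists_primeInter_pullbackFormDivisor_line_eq_of_tangent (hN : 1 ≤ N) {b : ℕ}
    (hb : height (genericPoint B.left) = b)
    {x y : Fin (N + 1) → B.left.functionField}
    (hxy : LinearIndependent B.left.functionField ![x, y])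
    {F : MvPolynomial (Fin (N + 1)) k} (hF : F ∈ grading (Fin (N + 1)) k 3) (hF0 : F ≠ 0)
    {c : B.left.functionField} (hc : c ≠ 0)
    (htan : ∀ s t : B.left.functionField,
      eval (s • x + t • y) (MvPolynomial.map (algebraMap k B.left.functionField) F) = c * s * t ^ 2)
    {μ : Fin (N - 1) → MvPolynomial (Fin (N + 1)) B.left.functionField}
    (hμli : LinearIndependent B.left.functionField μ) (hμhom : ∀ l, (μ l).IsHomogeneous 1)
    (hμx : ∀ l, eval x (μ l) = 0) (hμy : ∀ l, eval y (μ l) = 0)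
    (hμideal : ∀ G : MvPolynomial (Fin (N + 1)) B.left.functionField,
      (∀ s t : B.left.functionField, eval (s • x + t • y) G = 0) → G ∈ Ideal.span (Set.range μ)) :
    ∃ V : AlgebraicCycle ((projectiveSpace N k) ⊗ B).left ℤ,
      (pullbackFormDivisor (B := B) hF hF0).primeInter (X := (projectiveSpace N k) ⊗ B)
          (genericFibreι N B (linearSubspacePoint μ hμli hμhom (Nat.sub_le N 1))) =
        2 • primeCycle (genericFibreι N B
          (pointOfVec B.left.functionField x (by simpa using hxy.ne_zero 0)).pt) +
        primeCycle (genericFibreι N B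
          (pointOfVec B.left.functionField y (by simpa using hxy.ne_zero 1)).pt) + V ∧
      (∀ w, 0 ≤ V w) ∧
      ∀ w, V w ≠ 0 →
        genericFibreι N B (linearSubspacePoint μ hμli hμhom (Nat.sub_le N 1)) ⤳ w ∧
        height w = b ∧
        (CartesianMonoidalCategory.snd (projectiveSpace N k) B).left w ≠ genericPoint B.left ∧
        F ∈ ProjectiveSpectrum.asHomogeneousIdeal
          (𝒜 := MvPolynomial.homogeneousSubmodule (Fin (N + 1)) k)
          ((CartesianMonoidalCategory.fst (projectiveSpace N k) B).left w) := by
  haveI : Infinite B.left.functionField :=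
    Infinite.of_injective _ (algebraMap k B.left.functionField).injective
  have hx0 : x ≠ 0 := by simpa using hxy.ne_zero 0
  have hy0 : y ≠ 0 := by simpa using hxy.ne_zero 1
  -- `F ⊗ 1` is not on the line: `F(x + y) = c ≠ 0`
  have hFxy : eval (x + y) (MvPolynomial.map (algebraMap k B.left.functionField) F) ≠ 0 := by
    have h := htan 1 1
    rw [one_smul, one_smul] at h
    rw [h, one_pow, mul_one, mul_one]
    exact hc
  have hμxy : ∀ l, eval (x + y) (μ l) = 0 := fun l => by
    have h := eval_add_smul_of_isHomogeneous_one (hμhom l) 1 1 x y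
    rw [one_smul, one_smul, hμx l, hμy l, mul_zero, add_zero] at h
    exact h
  have hFlam : MvPolynomial.map (algebraMap k B.left.functionField) F ∉
      ProjectiveSpectrum.asHomogeneousIdeal
        (𝒜 := MvPolynomial.homogeneousSubmodule (Fin (N + 1)) B.left.functionField)
        (linearSubspacePoint μ hμli hμhom (Nat.sub_le N 1)) :=
    notMem_asHomogeneousIdeal_linearSubspacePoint_of_eval_ne_zero hμli hμhom hμxy hFxy
  -- `[x]`, `[y]` are closed points of the line
  have hline : ∀ (v : Fin (N + 1) → B.left.functionField) (hv0 : v ≠ 0), (∀ l, eval v (μ l) = 0) →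
      linearSubspacePoint μ hμli hμhom (Nat.sub_le N 1) ⤳ (pointOfVec B.left.functionField v hv0).pt := by
    intro v hv0 hv
    rw [specializes_iff_mem_closure, closure_linearSubspacePoint]
    rintro _ ⟨l, rfl⟩
    exact mem_asHomogeneousIdeal_pt_pointOfVec hv0 zero_lt_one (hμhom l) (hv l)
  obtain ⟨V, hV⟩ := exists_primeInter_pullbackFormDivisor_eq_smul_add_smul_add hN hb three_pos hF hF0
    hμli hμhom hFlam (hline x hx0 hμx) (height_pt _) (hline y hy0 hμy) (height_pt _)
    (m := 2) (m' := 1) fun hFK hFK0 => by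
      rw [one_nsmul]
      exact primeInter_formDivisor_line_eq_two_smul_add hN hxy hFK hFK0 hc htan hμli hμhom hμx hμy hμideal
  rw [one_nsmul] at hV
  exact ⟨V, hV⟩

end ProjFamily

end Literature.AlgebraicGeometry.Motives
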